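import Literature.RingTheory.FormalGroups.HondaTypeTransport
import Literature.NumberTheory.EllipticCurves.PAdicHeightsLogProofs
import Mathlib.NumberTheory.Padics.PadicNumbers
import Mathlib.Analysis.Normed.Group.Ultra
import Mathlib.Analysis.SpecificLimits.Normed
import HarnessLib

/-!
# Kobayashi's supersingular logarithm `log_{F_ss}(X) = ∑ₖ (−1)ᵏ ((1+X)^{p^{2k}} − 1)/pᵏ ∈ ℚ_p⟦X⟧`:
# definition (coefficients as convergent `p`-adic series), the growth bound `‖[Xᵈ] log_{F_ss}‖ ≤ d`,
# and its HONDA TYPE `T² + p` (cell `b2b-bsdres`, CLASS-CLOSURE lane, class O10 — x1b GEN 33, class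
# lead; file 27 of the local series: [K] §8.2, the input of Honda theory producing the points `c_n`)

HONEST FRAMING (cell `b2b-bsdres`, run/shared/lean/b2b/bsd-rank1-residual/, verbatim in every
file): the goal of the cell is to DELETE the COMBINATION-SHAPED residual classes of the
Birch–Swinnerton-Dyer formula for ALL analytic-rank `≤ 1` elliptic curves over `ℚ` — "full BSD
formula for every rank `≤ 1` curve in class `C`" assembled STRICTLY from published theorems — so
that the rank-`≤ 1` remainder becomes exactly the CONSTRUCTION-SHAPED classes, which are TYPED
(missing-input `Prop`s), NOT attempted. This is not "finishing BSD". CLASS-CLOSURE lane: prove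
what is provable now; shrink each hard class to its core with data; no claim beyond stated classes;
research routes on CONSTRUCTION-SHAPED X12 / O10; census / instrument output = EVIDENCE / conjecture
items, NEVER a Literature fact; `RESIDUAL-MAP.md` marks change only by signed lines. THIS FILE:
TOOL DEFINITIONS + THEOREMS (definitions with bodies: `logFssTerm`, `logFss`; every statement
proved) — no named Literature fact, no Summits-side fact `def … : Prop`, no `sorry`, axioms
standard; nothing is booked; no label / mark / count / sub-cell moves; O10 stays OPEN /
CONSTRUCTION-SHAPED; nothing about `BSD(W, p)` of any pair is claimed.

## Content

* §1 binomial coefficients: `[Xᵈ](1+X)^N = C(N,d)`, `‖C(pⁿ, d)‖ ≤ d·p⁻ⁿ`.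
* §2 `logFssTerm p k d = (−1)ᵏ (C(p^{2k}, d) − [d = 0])/pᵏ` (the `Xᵈ`-coefficient of
  `(−1)ᵏ((1+X)^{p^{2k}} − 1)/pᵏ`), `‖logFssTerm k d‖ ≤ d p⁻ᵏ`, summability in `k`;
  **`logFss p = ∑_d (∑'ₖ logFssTerm k d) Xᵈ`** ([K] §8.2), `logFss(0) = 0`, **`‖[Xᵈ]logFss‖ ≤ d`**.
* §3 **`norm_coeff_hondaShift_logFss_le_one`: `log_{F_ss}` is of Honda type `T² + p`**, i.e.
  `hondaShift p 0 logFss = logFss + (1/p)·logFss(X^{p²}) ∈ ℤ_p⟦X⟧` — from the congruence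
  `(1+X)^{p^{2k}} ≡ (1+X^{p²})^{p^{2k−2}} (mod p^{2k−1})` (the tree's `norm_coeff_pow_sq_sub_expand_le`
  and `norm_coeff_pow_prime_pow_sub_le`).

References: [Kobayashi2003] §8.2 (definition of `F_ss`, "of the Honda type `t² + p`");
[Honda1970] §2; M. Hazewinkel, *Formal Groups and Applications* (1978), I.2.
-/

noncomputable section

open scoped Classical Topology
open Filter PowerSeries

namespace Summit.BirchSwinnertonDyer.Rank1Residual.Additive

namespace HondaFss

open Literature.RingTheory.FormalGroups

variable (p : ℕ) [hp : Fact p.Prime]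

/-! ## §1 Binomial coefficients -/

/-- `[Xᵈ](1+X)^N = C(N, d)` in `ℚ_p⟦X⟧`. [folklore] -/
theorem coeff_one_add_X_pow (N d : ℕ) : coeff d ((1 + X : ℚ_[p]⟦X⟧) ^ N) = (N.choose d : ℚ_[p]) := by
  have h : ((1 + X : ℚ_[p]⟦X⟧) ^ N) = (((1 + Polynomial.X : Polynomial ℚ_[p]) ^ N : Polynomial ℚ_[p]) :
      ℚ_[p]⟦X⟧) := by
    rw [Polynomial.coe_pow, Polynomial.coe_add, Polynomial.coe_one, Polynomial.coe_X]
  rw [h, Polynomial.coeff_coe, Polynomial.coeff_one_add_X_pow]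

/-- **`‖C(pⁿ, d)‖ ≤ d · p⁻ⁿ`** (`d·C(pⁿ,d) = pⁿ·C(pⁿ−1, d−1)`; Kummer gives the exact value
`p^{−(n − v_p(d))}`). [folklore] -/
theorem norm_choose_prime_pow_le (n : ℕ) {d : ℕ} (hd : d ≠ 0) :
    ‖((p ^ n).choose d : ℚ_[p])‖ ≤ d * (p : ℝ)⁻¹ ^ n := by
  obtain ⟨e, rfl⟩ := Nat.exists_eq_succ_of_ne_zero hd
  rcases Nat.eq_zero_or_pos (p ^ n) with h0 | hpos
  · exact absurd h0 (pow_ne_zero n hp.out.ne_zero)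
  obtain ⟨N, hN⟩ := Nat.exists_eq_succ_of_ne_zero hpos.ne'
  -- `(e+1) C(N+1, e+1) = (N+1) C(N, e)`
  have hid : ((e + 1 : ℕ) : ℚ_[p]) * ((p ^ n).choose (e + 1) : ℚ_[p]) = (p : ℚ_[p]) ^ n * (N.choose e : ℚ_[p]) := by
    have h := Nat.add_one_mul_choose_eq N e
    have hN' : N + 1 = p ^ n := hN.symm
    rw [hN'] at h
    have h' : ((p ^ n : ℕ) : ℚ_[p]) * (N.choose e : ℚ_[p]) = ((p ^ n).choose (e + 1) : ℚ_[p]) * ((e + 1 : ℕ) : ℚ_[p]) := by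
      exact_mod_cast h
    rw [Nat.cast_pow] at h'
    linear_combination -h'
  have he : ((e + 1 : ℕ) : ℚ_[p]) ≠ 0 := Nat.cast_ne_zero.mpr (Nat.succ_ne_zero e)
  have hC : ((p ^ n).choose (e + 1) : ℚ_[p]) = ((e + 1 : ℕ) : ℚ_[p])⁻¹ * ((p : ℚ_[p]) ^ n * (N.choose e : ℚ_[p])) := by
    rw [← hid, ← mul_assoc, inv_mul_cancel₀ he, one_mul]
  rw [hC, norm_mul, norm_mul, norm_pow, Padic.norm_p]
  calc ‖((e + 1 : ℕ) : ℚ_[p])⁻¹‖ * ((p : ℝ)⁻¹ ^ n * ‖(N.choose e : ℚ_[p])‖)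
      ≤ ((e + 1 : ℕ) : ℝ) * ((p : ℝ)⁻¹ ^ n * 1) := by
        refine mul_le_mul (Literature.NumberTheory.EllipticCurves.norm_inv_natCast_le (p := p) (Nat.succ_ne_zero e)) ?_
          (by positivity) (Nat.cast_nonneg _)
        exact mul_le_mul_of_nonneg_left (by simpa using Padic.norm_int_le_one (p := p) (N.choose e : ℤ)) (by positivity)
    _ = ((e + 1 : ℕ) : ℝ) * (p : ℝ)⁻¹ ^ n := by rw [mul_one]

/-! ## §2 The series `log_{F_ss}` -/

/-- **The `Xᵈ`-coefficient of `(−1)ᵏ((1+X)^{p^{2k}} − 1)/pᵏ`**: `(−1)ᵏ (C(p^{2k}, d) − [d = 0]) / pᵏ`.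
[cite: Kobayashi2003, §8.2] -/
def logFssTerm (k d : ℕ) : ℚ_[p] :=
  (-1) ^ k * (((p ^ (2 * k)).choose d : ℚ_[p]) - if d = 0 then 1 else 0) / (p : ℚ_[p]) ^ k

/-- `logFssTerm k d` is the coefficient of `(−1)ᵏ((1+X)^{p^{2k}} − 1)/pᵏ`. [folklore] -/
theorem coeff_term (k d : ℕ) :
    coeff d (C ((-1) ^ k / (p : ℚ_[p]) ^ k) * ((1 + X : ℚ_[p]⟦X⟧) ^ p ^ (2 * k) - 1)) = logFssTerm p k d := by
  rw [coeff_C_mul, map_sub, coeff_one_add_X_pow, coeff_one, logFssTerm]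
  ring

/-- `logFssTerm k 0 = 0`. [folklore] -/
theorem logFssTerm_zero (k : ℕ) : logFssTerm p k 0 = 0 := by
  simp [logFssTerm]

/-- **`‖logFssTerm k d‖ ≤ d p⁻ᵏ`.** [folklore] -/
theorem norm_logFssTerm_le (k d : ℕ) : ‖logFssTerm p k d‖ ≤ d * (p : ℝ)⁻¹ ^ k := by
  rcases Nat.eq_zero_or_pos d with rfl | hd
  · simp [logFssTerm_zero]
  rw [logFssTerm, if_neg hd.ne', sub_zero, norm_div, norm_mul, norm_pow, norm_neg, norm_one, one_pow, one_mul,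
    norm_pow, Padic.norm_p]
  have h := norm_choose_prime_pow_le p (2 * k) hd.ne'
  have hp0 : (0 : ℝ) < p := by exact_mod_cast hp.out.pos
  rw [div_le_iff₀ (by positivity)]
  calc ‖((p ^ (2 * k)).choose d : ℚ_[p])‖ ≤ d * (p : ℝ)⁻¹ ^ (2 * k) := h
    _ = d * (p : ℝ)⁻¹ ^ k * (p : ℝ)⁻¹ ^ k := by rw [two_mul, pow_add, mul_assoc]

/-- The terms are summable in `k` (geometric majorant). [folklore] -/
theorem summable_logFssTerm (d : ℕ) : Summable fun k : ℕ => logFssTerm p k d := by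
  refine Summable.of_norm_bounded (g := fun k : ℕ => (d : ℝ) * (p : ℝ)⁻¹ ^ k) ?_ (norm_logFssTerm_le p · d)
  have hr : (p : ℝ)⁻¹ < 1 := inv_lt_one_of_one_lt₀ (by exact_mod_cast hp.out.one_lt)
  exact (summable_geometric_of_lt_one (by positivity) hr).mul_left _

/-- **Kobayashi's `log_{F_ss}(X) = ∑ₖ (−1)ᵏ((1+X)^{p^{2k}} − 1)/pᵏ`**, as the power series whose
`Xᵈ`-coefficient is the convergent `p`-adic sum `∑'ₖ logFssTerm k d`. [cite: Kobayashi2003, §8.2] -/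
def logFss : ℚ_[p]⟦X⟧ := PowerSeries.mk fun d => ∑' k : ℕ, logFssTerm p k d

/-- The coefficients of `logFss`. [folklore] -/
theorem coeff_logFss (d : ℕ) : coeff d (logFss p) = ∑' k : ℕ, logFssTerm p k d := by
  rw [logFss, coeff_mk]

/-- `logFss(0) = 0`. [folklore] -/
theorem constantCoeff_logFss : constantCoeff (logFss p) = 0 := by
  rw [← coeff_zero_eq_constantCoeff, coeff_logFss]
  simp [logFssTerm_zero]

/-- **`‖[Xᵈ] log_{F_ss}‖ ≤ d`** (logarithmic growth, as for `log_E`). [folklore] -/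
theorem norm_coeff_logFss_le (d : ℕ) : ‖coeff d (logFss p)‖ ≤ d := by
  rw [coeff_logFss]
  refine IsUltrametricDist.norm_tsum_le_of_forall_le_of_nonneg (Nat.cast_nonneg d) fun k => ?_
  refine (norm_logFssTerm_le p k d).trans ?_
  have h1 : (p : ℝ)⁻¹ ^ k ≤ 1 := pow_le_one₀ (by positivity) (inv_le_one_of_one_le₀ (by exact_mod_cast hp.out.one_lt.le))
  calc (d : ℝ) * (p : ℝ)⁻¹ ^ k ≤ d * 1 := mul_le_mul_of_nonneg_left h1 (Nat.cast_nonneg d)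
    _ = d := mul_one _

/-- `[X¹] log_{F_ss} = ∑ₖ (−p)ᵏ` has norm `1` (its `k = 0` term is `1`, the others are in `pℤ_p`).
[folklore] -/
theorem norm_coeff_one_logFss : ‖coeff 1 (logFss p)‖ = 1 := by
  rw [coeff_logFss]
  have hs := summable_logFssTerm p 1
  rw [hs.tsum_eq_zero_add]
  have h0 : logFssTerm p 0 1 = 1 := by simp [logFssTerm]
  have htail : ‖∑' k : ℕ, logFssTerm p (k + 1) 1‖ < 1 := by
    have hr : (p : ℝ)⁻¹ < 1 := inv_lt_one_of_one_lt₀ (by exact_mod_cast hp.out.one_lt)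
    refine (IsUltrametricDist.norm_tsum_le_of_forall_le_of_nonneg (le_of_lt (inv_pos.mpr
      (by exact_mod_cast hp.out.pos : (0:ℝ) < p))) fun k => ?_).trans_lt hr
    refine (norm_logFssTerm_le p (k + 1) 1).trans ?_
    rw [Nat.cast_one, one_mul, pow_succ]
    exact mul_le_of_le_one_left (by positivity) (pow_le_one₀ (by positivity) hr.le)
  rw [h0, IsUltrametricDist.norm_add_eq_max_of_norm_ne_norm, norm_one, max_eq_left htail.le]
  rw [norm_one]; exact (ne_of_lt htail).symm

/-! ## §3 The Honda type `T² + p` -/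

/-- **The congruence `(1+X)^{p^{2k+2}} ≡ (1+X^{p²})^{p^{2k}} (mod p^{2k+1})`**, coefficientwise.
[Hazewinkel 1978, I.2.3] [folklore] -/
theorem norm_coeff_pow_sub_expand_pow_le (k n : ℕ) :
    ‖coeff n ((1 + X : ℚ_[p]⟦X⟧) ^ p ^ (2 * k + 2) -
      expand (p ^ 2) (prime_sq_ne_zero p) ((1 + X : ℚ_[p]⟦X⟧) ^ p ^ (2 * k)))‖ ≤ (p : ℝ)⁻¹ ^ (2 * k + 1) := by
  have hXc : ∀ m, ‖coeff m (X : ℚ_[p]⟦X⟧)‖ ≤ 1 := by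
    intro m
    rw [coeff_X]
    by_cases hm : m = 1
    · rw [if_pos hm, norm_one]
    · rw [if_neg hm, norm_zero]; exact zero_le_one
  have h1X : ∀ m, ‖coeff m (1 + X : ℚ_[p]⟦X⟧)‖ ≤ 1 := norm_coeff_add_le norm_coeff_one_le hXc
  -- `α = (1+X)^{p²}`, `β = (1+X)(X^{p²}) = 1 + X^{p²}`: `α ≡ β (mod p)`
  have hαβ := norm_coeff_pow_sq_sub_expand_le h1X
  have hβ : ∀ m, ‖coeff m (expand (p ^ 2) (prime_sq_ne_zero p) (1 + X : ℚ_[p]⟦X⟧))‖ ≤ 1 :=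
    norm_coeff_expand_le _ zero_le_one h1X
  have h := norm_coeff_pow_prime_pow_sub_le (s := 1) le_rfl hβ
    (fun m => by simpa using hαβ m) (2 * k) n
  have e1 : ((1 + X : ℚ_[p]⟦X⟧) ^ p ^ 2) ^ p ^ (2 * k) = (1 + X : ℚ_[p]⟦X⟧) ^ p ^ (2 * k + 2) := by
    rw [← pow_mul, ← pow_add, Nat.add_comm 2 (2 * k)]
  have e2 : (expand (p ^ 2) (prime_sq_ne_zero p) (1 + X : ℚ_[p]⟦X⟧)) ^ p ^ (2 * k) =
      expand (p ^ 2) (prime_sq_ne_zero p) ((1 + X : ℚ_[p]⟦X⟧) ^ p ^ (2 * k)) := by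
    rw [map_pow]
  rw [e1, e2, add_comm 1 (2 * k)] at h
  exact h

/-- The combined term `logFssTerm (k+1) n + (1/p)·[p² ∣ n]·logFssTerm k (n/p²)` is the
`Xⁿ`-coefficient of `(−1)^{k+1}((1+X)^{p^{2k+2}} − (1+X^{p²})^{p^{2k}})/p^{k+1}`, hence integral.
[cite: Kobayashi2003, §8.2] -/
theorem norm_combined_le_one (k n : ℕ) :
    ‖logFssTerm p (k + 1) n + 1 / (p : ℚ_[p]) * (if p ^ 2 ∣ n then logFssTerm p k (n / p ^ 2) else 0)‖ ≤ 1 := by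
  have hp0 : (p : ℚ_[p]) ≠ 0 := Nat.cast_ne_zero.mpr hp.out.ne_zero
  -- express as a coefficient
  set D : ℚ_[p]⟦X⟧ := (1 + X : ℚ_[p]⟦X⟧) ^ p ^ (2 * k + 2) -
      expand (p ^ 2) (prime_sq_ne_zero p) ((1 + X : ℚ_[p]⟦X⟧) ^ p ^ (2 * k)) with hD
  have hcoeff : logFssTerm p (k + 1) n + 1 / (p : ℚ_[p]) * (if p ^ 2 ∣ n then logFssTerm p k (n / p ^ 2) else 0) =
      (-1) ^ (k + 1) / (p : ℚ_[p]) ^ (k + 1) * coeff n D := by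
    rw [hD, map_sub, coeff_one_add_X_pow, coeff_expand]
    by_cases hdiv : p ^ 2 ∣ n
    · rw [if_pos hdiv, if_pos hdiv, coeff_one_add_X_pow, logFssTerm, logFssTerm]
      have hn0 : (n = 0 ↔ n / p ^ 2 = 0) := by
        obtain ⟨q, rfl⟩ := hdiv
        rw [Nat.mul_div_cancel_left _ (pos_of_gt (Nat.one_lt_pow two_ne_zero hp.out.one_lt))]
        constructor
        · intro h; exact (mul_eq_zero.mp h).resolve_left (pow_ne_zero 2 hp.out.ne_zero)
        · rintro rfl; simp
      by_cases hn : n = 0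
      · rw [if_pos hn, if_pos (hn0.mp hn)]
        rw [show 2 * (k + 1) = 2 * k + 2 by ring, pow_succ, pow_succ]
        field_simp
        ring
      · rw [if_neg hn, if_neg (mt hn0.mpr hn)]
        rw [show 2 * (k + 1) = 2 * k + 2 by ring, pow_succ, pow_succ]
        field_simp
        ring
    · rw [if_neg hdiv, if_neg hdiv, mul_zero, add_zero, sub_zero, logFssTerm]
      have hn : n ≠ 0 := by rintro rfl; exact hdiv (dvd_zero _)
      rw [if_neg hn, sub_zero, show 2 * (k + 1) = 2 * k + 2 by ring]
      ring
  rw [hcoeff, norm_mul, norm_div, norm_pow, norm_neg, norm_one, one_pow, norm_pow, Padic.norm_p, one_div]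
  have h := norm_coeff_pow_sub_expand_pow_le p k n
  rw [← hD] at h
  have hp1 : (1 : ℝ) ≤ p := by exact_mod_cast hp.out.one_lt.le
  calc ((p : ℝ)⁻¹ ^ (k + 1))⁻¹ * ‖coeff n D‖ ≤ ((p : ℝ)⁻¹ ^ (k + 1))⁻¹ * (p : ℝ)⁻¹ ^ (2 * k + 1) :=
        mul_le_mul_of_nonneg_left h (by positivity)
    _ = (p : ℝ)⁻¹ ^ k := by
        have hq : (p : ℝ)⁻¹ ^ (k + 1) ≠ 0 := pow_ne_zero _ (inv_ne_zero (by positivity))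
        rw [show 2 * k + 1 = (k + 1) + k by ring, pow_add ((p : ℝ)⁻¹) (k + 1) k, ← mul_assoc,
          inv_mul_cancel₀ hq, one_mul]
    _ ≤ 1 := pow_le_one₀ (by positivity) (inv_le_one_of_one_le₀ hp1)

/-- **`log_{F_ss}` is of Honda type `T² + p`**: `hondaShift p 0 log_{F_ss} ∈ ℤ_p⟦X⟧`.
[cite: Kobayashi2003, §8.2] -/
theorem norm_coeff_hondaShift_logFss_le_one (n : ℕ) : ‖coeff n (hondaShift p 0 (logFss p))‖ ≤ 1 := by
  rw [coeff_hondaShift, zero_div, zero_mul, sub_zero, coeff_logFss]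
  have hs := summable_logFssTerm p n
  -- the second summand as a tsum over `k`
  have h2 : 1 / (p : ℚ_[p]) * (if p ^ 2 ∣ n then coeff (n / p ^ 2) (logFss p) else 0) =
      ∑' k : ℕ, 1 / (p : ℚ_[p]) * (if p ^ 2 ∣ n then logFssTerm p k (n / p ^ 2) else 0) := by
    split_ifs with h
    · rw [coeff_logFss, ← tsum_mul_left]
    · simp
  have hs2 : Summable fun k : ℕ => 1 / (p : ℚ_[p]) * (if p ^ 2 ∣ n then logFssTerm p k (n / p ^ 2) else 0) := by
    split_ifs
    · exact (summable_logFssTerm p _).mul_left _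
    · simp
  rw [h2, hs.tsum_eq_zero_add, add_assoc, ← (((summable_nat_add_iff 1).mpr hs)).tsum_add hs2]
  -- `k = 0` term: `C(1, n) − [n = 0]` is `[n = 1]`
  have h0 : ‖logFssTerm p 0 n‖ ≤ 1 := by
    have e : logFssTerm p 0 n = ((Nat.choose 1 n : ℕ) : ℚ_[p]) - if n = 0 then 1 else 0 := by
      simp [logFssTerm]
    rw [e]
    rcases n with _ | _ | n
    · simp
    · simp
    · rw [if_neg (by omega), sub_zero, Nat.choose_eq_zero_of_lt (by omega)]; simp
  refine (IsUltrametricDist.norm_add_le_max _ _).trans (max_le h0 ?_)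
  exact IsUltrametricDist.norm_tsum_le_of_forall_le_of_nonneg zero_le_one fun k => norm_combined_le_one p k n

end HondaFss

end Summit.BirchSwinnertonDyer.Rank1Residual.Additive

end
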